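import Summits.BirchSwinnertonDyer.BirchSwinnertonDyer.Theorems.AdditiveKolyvaginRoadKolyvaginSupplyOfPoitouTate
import Literature.NumberTheory.EllipticCurves.HeegnerPointsKolyvaginCebotarevProofs
import HarnessLib

/-!
# Route `AdditiveKolyvaginRoad`, crux KS′ `LevelKolyvaginSystemsAdditive` (item stmt-BirchSwinnertonDyer-21396):
# the TWIN DICHOTOMY for the mixed Selmer spaces, JUMP binder — a DETECTED eigenclass of each sign in the `λ`-relaxed mixed structure
# (W. Zhang Lemma 8.2 signed, from Poitou–Tate), and `hJump` modulo the LOCAL TRICHOTOMY at a Kolyvagin prime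
# (cell `pub/bsd-wall`, width seat `bsd-wall-akr-p2x-w2` g6; `--supports stmt-BirchSwinnertonDyer-21396`, helper; with `…TwinDrop` (`hDrop`) and
# `…TwinRise` (`hRise`) this reduces the (Twin) input of `nonempty_levelKolyvaginSystemP_of_seed_of_twin` to ONE local statement)

WHY. (Twin) = `hDrop` ∧ `hRise` ∧ `hJump` for the mixed spaces `Sel(m, n)^μ` (Howard 2004 Lemma 2.5.3). `hDrop` and `hRise` are tree theorems of this
seat (Poitou–Tate-free). `hJump` — «at a non-empty level one of `Sel(m, n)^μ`, `Sel(mℓ, n)^μ` has a class detected at the place `λ` of `ℓ`» — is the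
Poitou–Tate JUMP plus a local statement. THIS FILE:
* §1 `exists_detected_eigen_mixedRelaxed` — at a non-empty admissible level, for a Kolyvagin prime `ℓ ∉ m` and each sign `μ`, a `μ`-eigenclass of
  the `λ`-RELAXED mixed structure (Kummer at `∞` and off `m ∪ n ∪ {ℓ}`, toric on `n`, transverse on `m`, free at `λ`) NOT locally trivial at `λ`.
  This is the tree's signed supply `hSupply_of_poitouTateP` ∕ `supply_signed_of_jumpP` (W. Zhang Lemma 8.2: `hjump_of_poitouTateP` + eigen-decomposition
  `exists_eigen_decomposition` + (IsoBound) `sub_zsmul_mem_torsionLocalKer_of_isotropic_P` + `exists_eigen_not_mem_of_jump`), re-run with its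
  conclusion kept in the STRONG form the proof yields (`x ∉ torsionLocalKer_λ` instead of `x ≠ 0`) and in place currency. Inputs: Poitou–Tate
  (`poitouTate_selmerStructure_duality K`), `d_K < −4`, `p` odd, `ρ̄` onto, `c ≠ 1`.
* §2 `twinJump_mixed_of_trich` — `hJump` VERBATIM from §1 and the LOCAL TRICHOTOMY (TRICH, hypothesis): «a `μ`-eigenclass of the `λ`-relaxed mixed
  structure not Kummer at `λ` is transverse at `λ`» (the isotropic lines of the hyperbolic eigen-plane `H¹(K_λ, E[p])^μ` are `H¹_f^μ` and `H¹_tr^μ`;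
  route in the tree's currency: `h1Eval_frob_eq_zero_of_cupProduct_self_eq_zero_P` gives `[x, F] = 0` at Gross's symmetric Frobenius lift, and
  `χ(F)² = 1` in the dihedral `Gal(K[ℓ]/ℚ)` makes `{φ(F) = 0}` the transverse condition).

NET for crux KS′ (with `…OfSeedOfTwin`, `…OfKolyvaginPrimitiveOfTwin`, `…TwinDrop`, `…TwinRise`): KS′(frame) ⟸ seed ∧ PUB ∧ DUAL ∧ TRICH; on the good-avatar
locus of line `epsilon_matched_retyping` the seed is Kriz–Li's, so the datum clause of skeleton v9 is reduced to TRICH — a local statement at one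
Kolyvagin prime, in print (Gross 1991 §8, Howard 2004 Lemma 2.5.3), not yet typed.

HONEST FRAMING: theorems only; 0 definitions, 0 named facts, 0 `sorry`; §1 CONDITIONAL on the Poitou–Tate fact (hypothesis), §2 on TRICH (hypothesis);
the `ZMod p`-structures of the local `H¹(K_v, E[p])` are instance binders (any choice). Closes nothing. BSD is not proved by any of this; KS′ OPEN.

References: [cite: WZhang2014, Lemma 8.2, Lemma 8.4] [cite: Howard2004HeegnerKolyvagin, Thm. 2.1.11, Lemma 2.5.3] [cite: McCallumLMS1991, Prop. 2.1,
Lemma 5.3] [cite: GrossLMS1991, Prop. 8.1, Prop. 8.2, Prop. 9.6] [cite: MilneADT2006, Ch. I, Thm. 4.10].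
-/

set_option linter.dupNamespace false -- single-conjunct summit repeats the name by design

noncomputable section

open scoped Classical Pointwise

namespace Summit.BirchSwinnertonDyer.BirchSwinnertonDyer.Theorems.AdditiveKoly

open CategoryTheory WeierstrassCurve Field Function NumberField IsDedekindDomain
open Literature.NumberTheory.EllipticCurves Literature.NumberTheory.EllipticCurves.ModularForms
  Literature.NumberTheory.GaloisRepresentations Module
open Literature.NumberTheory.GaloisCohomology
open Summit.BirchSwinnertonDyer.Rank1Residual.X11b.Three.Koly.Method2
open Summit.BirchSwinnertonDyer.Rank1Residual.X11b.Three.Koly.ZhangSupply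
open scoped ContRepresentation

variable (W : WeierstrassCurve ℚ) (K : Type) [Field K] [NumberField K] (p : ℕ) [W.IsElliptic] [W.IsGloballyMinimal]
  [Fact p.Prime] (c : K ≃ₐ[ℚ] K) (ι : K →+* ℂ) [Module (ZMod p) (Vp W K p)]

/-! ## §1 A DETECTED eigenclass of each sign in the `λ`-relaxed mixed structure (W. Zhang Lemma 8.2, sharpened) -/

/-- **The Poitou–Tate jump, SIGNED and DETECTED, for the `λ`-relaxed mixed structure.** Frame: `K` imaginary quadratic with `d_K < −4`, `p` odd,
`ρ̄_{E,p}` onto, `c ≠ 1`, Poitou–Tate duality for Selmer structures over `K`. For a NON-EMPTY admissible level `n`, a Kolyvagin prime `ℓ ∉ m` with place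
`v`, and each sign `μ`: some `μ`-eigenclass which is Kummer at the infinite places and at the finite places under no prime of `m ∪ n ∪ {ℓ}`, TORIC
above `n`, TRANSVERSE above `m` (nothing asked at `v`) is NOT locally trivial at `v`. This is the tree's `hSupply_of_poitouTateP` ∕ `supply_signed_of_jumpP`
(W. Zhang Lemma 8.2 signed: (J) `hjump_of_poitouTateP` + eigen-decomposition + (IsoBound)) with its conclusion kept in the STRONG form the proof gives
(`x ∉ torsionLocalKer_v`, not merely `x ≠ 0`) and in place currency. [cite: WZhang2014, Lemma 8.2] [cite: McCallumLMS1991, Lemma 5.3]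
[cite: Howard2004HeegnerKolyvagin, Thm. 2.1.11, Lemma 2.5.3] -/
theorem exists_detected_eigen_mixedRelaxed
    [∀ v : Place K, Module (ZMod p) (galoisCohomology (((W.baseChange K).torsionGaloisModule ((p ^ 1 : ℕ) : ℤ)).toLocal v) 1)]
    (hK : IsImaginaryQuadratic K) (hp2 : p ≠ 2) (hd : NumberField.discr K < -4)
    (hsurj : W.HasSurjectiveModNGaloisRep p) (hc : c ≠ 1) (hPT : poitouTate_selmerStructure_duality K)
    (m : Finset {ℓ // Zhang2014.IsKolyvaginPrime (W.conductorNorm ℤ) W K p ℓ}) (ℓ : {ℓ // Zhang2014.IsKolyvaginPrime (W.conductorNorm ℤ) W K p ℓ}) (hℓm : ℓ ∉ m) (n : Finset (AdmQ W K p)) (hn : n.Nonempty)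
    (v : HeightOneSpectrum (𝓞 K)) (hv : ((ℓ : ℕ) : 𝓞 K) ∈ v.asIdeal) (μ : Bool) :
    ∃ x : Vp W K p, conjAct W c ((p ^ 1 : ℕ) : ℤ) x = sgnP μ • x ∧
      ((∀ w : InfinitePlace K, x ∈ selmerLocalKer (W.baseChange K) w.Completion ((p ^ 1 : ℕ) : ℤ)) ∧
      (∀ w : HeightOneSpectrum (𝓞 K), ((ℓ : ℕ) : 𝓞 K) ∉ w.asIdeal → (∀ ℓ' ∈ m, ((ℓ' : ℕ) : 𝓞 K) ∉ w.asIdeal) →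
        (∀ q ∈ n, ((q : ℕ) : 𝓞 K) ∉ w.asIdeal) → x ∈ selmerLocalKer (W.baseChange K) (w.adicCompletion K) ((p ^ 1 : ℕ) : ℤ)) ∧
      (∀ q ∈ n, ∀ w : HeightOneSpectrum (𝓞 K), ((q : ℕ) : 𝓞 K) ∈ w.asIdeal →
        x ∈ toricLocalKer (W.baseChange K) (w.adicCompletion K) ((p ^ 1 : ℕ) : ℤ)) ∧
      (∀ ℓ' ∈ m, ∀ w : HeightOneSpectrum (𝓞 K), ((ℓ' : ℕ) : 𝓞 K) ∈ w.asIdeal → x ∈ transverseLocalKerP W K p ι ℓ' w)) ∧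
      x ∉ (W.baseChange K).torsionLocalKer (v.adicCompletion K) ((p ^ 1 : ℕ) : ℤ) := by
  have hp : p.Prime := Fact.out
  haveI : IsTotallyComplex K := hK.2
  haveI : NeZero (p ^ 1 : ℕ) := ⟨pow_ne_zero 1 hp.ne_zero⟩
  haveI : ∀ v : Place K, CompactSpace (absoluteGaloisGroup (Place.Completion v)) := fun v ↦ absoluteGaloisGroup_compactSpace _
  haveI : Finite (geomTorsion (W.baseChange K) ((p ^ 1 : ℕ) : ℤ)) := finite_geomTorsion_of_neZero (W.baseChange K) (p ^ 1)
  -- the places of the Kolyvagin primes (normalised so that `plK ℓ = v`)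
  let plK : {ℓ // Zhang2014.IsKolyvaginPrime (W.conductorNorm ℤ) W K p ℓ} → HeightOneSpectrum (𝓞 K) := fun ℓ' ↦
    ⟨Ideal.span {((ℓ' : ℕ) : 𝓞 K)}, ℓ'.2.2.2.2.2.1, by rw [Ne, Ideal.span_singleton_eq_bot]; exact_mod_cast ℓ'.2.1.ne_zero⟩
  have hplK : ∀ ℓ', ((ℓ' : ℕ) : 𝓞 K) ∈ (plK ℓ').asIdeal := fun ℓ' ↦ Ideal.mem_span_singleton_self _
  have hcur := ne_plK_iff_not_mem W K p plK hplK
  have hvℓ : plK ℓ = v := placesAbove_eq_of_isPrime_span K ℓ.2.2.2.2.2.1 ℓ.2.1.ne_zero hv (hplK ℓ)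
  -- the localisations, a Weil pairing, the Poitou–Tate family, the local forms
  let loc : (v : Place K) → Vp W K p →ₗ[ZMod p] galoisCohomology (((W.baseChange K).torsionGaloisModule ((p ^ 1 : ℕ) : ℤ)).toLocal v) 1 := fun v ↦
    (show Vp W K p →+ galoisCohomology (((W.baseChange K).torsionGaloisModule ((p ^ 1 : ℕ) : ℤ)).toLocal v) 1 from galoisCohomology.localization ((W.baseChange K).torsionGaloisModule ((p ^ 1 : ℕ) : ℤ)) v 1).toZModLinearMap p
  have hloc : ∀ (v : Place K) (x : Vp W K p), loc v x = galoisCohomology.localization ((W.baseChange K).torsionGaloisModule ((p ^ 1 : ℕ) : ℤ)) v 1 x := fun _ _ ↦ rfl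
  obtain ⟨e, hμ, hadd₁, hadd₂, halt, hnondeg, hgal⟩ :=
    exists_weilPairing_holds (W.baseChange K) (p ^ 1) (by rw [pow_one]; exact hp.two_le) (by
      rw [pow_one]; exact_mod_cast hp.ne_zero)
  obtain ⟨inv, hinvperf, hPTsum⟩ := poitouTate_sum_localTatePairing_eq_zero_of_isTotallyComplex K (p ^ 1)
  obtain ⟨b, hb⟩ := exists_zmodBilinear_invCupProduct_P W K p e hμ hadd₁ hadd₂ hgal inv
  have hinj : ∀ v : HeightOneSpectrum (𝓞 K), Injective (inv (Sum.inr v)) := fun v ↦ (hinvperf v).1.1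
  have hrec : ∀ (x y : Vp W K p) (T : Finset (Place K)), (∀ v, v ∉ T → b v (loc v x) (loc v y) = 0) →
      ∑ v ∈ T, b v (loc v x) (loc v y) = 0 := fun x y T hT ↦ sum_invCupProduct_eq_zero_P W K p hb hPTsum x y T hT
  have hisoKum := fun v ↦ invCupProduct_eq_zero_of_mem_kummer_P W K p hb halt v
  have hisoTor : ∀ (q : AdmQ W K p) (v : HeightOneSpectrum (𝓞 K)), ((q : ℕ) : 𝓞 K) ∈ v.asIdeal →
      ∀ (x y : Vp W K p),
      x ∈ toricLocalKer (W.baseChange K) (v.adicCompletion K) ((p ^ 1 : ℕ) : ℤ) →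
      y ∈ toricLocalKer (W.baseChange K) (v.adicCompletion K) ((p ^ 1 : ℕ) : ℤ) →
      b (Sum.inr v) (loc (Sum.inr v) x) (loc (Sum.inr v) y) = 0 :=
    fun q v hqv x y hx hy ↦ invCupProduct_eq_zero_of_mem_toric_P W K p hb hK.1 halt q v hqv x y hx hy
  have hisoTr : ∀ (ℓ : {ℓ // Zhang2014.IsKolyvaginPrime (W.conductorNorm ℤ) W K p ℓ}) (x y : Vp W K p),
      x ∈ transverseLocalKerP W K p ι ℓ (plK ℓ) → y ∈ transverseLocalKerP W K p ι ℓ (plK ℓ) →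
      b (Sum.inr (plK ℓ)) (loc (Sum.inr (plK ℓ)) x) (loc (Sum.inr (plK ℓ)) y) = 0 := by
    intro ℓ x y hx hy
    rw [hb, hloc, hloc, cupProduct_eq_zero_of_mem_transverseLocalKerP W K p hK ι hp2 e hμ hadd₁ hadd₂ hgal ℓ ℓ.2
      (plK ℓ) (hplK ℓ) x y hx hy]
    exact (congrArg (ZMod.ringEquivCongr (pow_one p)) (map_zero (inv (Sum.inr (plK ℓ))))).trans (map_zero _)
  have hjump := hjump_of_poitouTateP W K p hK hp2 hd hPT ι plK hplK
  have hcup0 : ∀ (ℓ : {ℓ // Zhang2014.IsKolyvaginPrime (W.conductorNorm ℤ) W K p ℓ}) (x y : Vp W K p),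
      b (Sum.inr (plK ℓ)) (loc (Sum.inr (plK ℓ)) x) (loc (Sum.inr (plK ℓ)) y) = 0 →
      (weilContPairingLocal (W.baseChange K) (p ^ 1) e hμ hadd₁ hadd₂ hgal (Sum.inr (plK ℓ))).cupProduct
        (galoisCohomology.localization ((W.baseChange K).torsionGaloisModule ((p ^ 1 : ℕ) : ℤ)) (Sum.inr (plK ℓ)) 1 x)
        (galoisCohomology.localization ((W.baseChange K).torsionGaloisModule ((p ^ 1 : ℕ) : ℤ)) (Sum.inr (plK ℓ)) 1 y) = 0 := by
    intro ℓ x y h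
    rw [hb, hloc, hloc] at h
    have h' := (EmbeddingLike.map_eq_zero_iff (f := ZMod.ringEquivCongr (pow_one p))).mp h
    exact hinj _ (h'.trans (map_zero _).symm)
  have hbound : ∀ (ℓ : {ℓ // Zhang2014.IsKolyvaginPrime (W.conductorNorm ℤ) W K p ℓ}) (s : Bool) (x y : Vp W K p),
      conjAct W c ((p ^ 1 : ℕ) : ℤ) x = sgnP s • x → conjAct W c ((p ^ 1 : ℕ) : ℤ) y = sgnP s • y →
      b (Sum.inr (plK ℓ)) (loc (Sum.inr (plK ℓ)) x) (loc (Sum.inr (plK ℓ)) x) = 0 →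
      b (Sum.inr (plK ℓ)) (loc (Sum.inr (plK ℓ)) x) (loc (Sum.inr (plK ℓ)) y) = 0 →
      b (Sum.inr (plK ℓ)) (loc (Sum.inr (plK ℓ)) y) (loc (Sum.inr (plK ℓ)) x) = 0 →
      b (Sum.inr (plK ℓ)) (loc (Sum.inr (plK ℓ)) y) (loc (Sum.inr (plK ℓ)) y) = 0 →
      x ∉ (W.baseChange K).torsionLocalKer ((plK ℓ).adicCompletion K) ((p ^ 1 : ℕ) : ℤ) →
      ∃ a : ℤ, y - a • x ∈ (W.baseChange K).torsionLocalKer ((plK ℓ).adicCompletion K) ((p ^ 1 : ℕ) : ℤ) :=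
    fun ℓ s x y hxs hys h11 h12 h21 h22 hx0 ↦
      sub_zsmul_mem_torsionLocalKer_of_isotropic_P W K p hK hp2 hsurj hc e hμ hadd₁ hadd₂ halt hnondeg hgal ℓ.2 (plK ℓ)
        (hplK ℓ) s hxs hys (hcup0 ℓ x x h11) (hcup0 ℓ x y h12) (hcup0 ℓ y x h21) (hcup0 ℓ y y h22) hx0
  -- the relaxed group `G = G(n, ℓ, m)` in `plK` currency, as in `supply_signed_of_jumpP`
  let G : AddSubgroup (Vp W K p) :=
    { carrier := {x | ((∀ w : InfinitePlace K, x ∈ selmerLocalKer (W.baseChange K) w.Completion ((p ^ 1 : ℕ) : ℤ)) ∧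
          (∀ v : HeightOneSpectrum (𝓞 K), v ≠ plK ℓ → (∀ ℓ' ∈ m, plK ℓ' ≠ v) →
            ((∀ q ∈ n, ((q : ℕ) : 𝓞 K) ∉ v.asIdeal) →
              x ∈ selmerLocalKer (W.baseChange K) (v.adicCompletion K) ((p ^ 1 : ℕ) : ℤ)) ∧
            (∀ q ∈ n, ((q : ℕ) : 𝓞 K) ∈ v.asIdeal →
              x ∈ toricLocalKer (W.baseChange K) (v.adicCompletion K) ((p ^ 1 : ℕ) : ℤ))) ∧
          (∀ ℓ' ∈ m, x ∈ transverseLocalKerP W K p ι ℓ' (plK ℓ'))) }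
      add_mem' := fun {x y} hx hy ↦
        ⟨fun w ↦ add_mem (hx.1 w) (hy.1 w),
          fun v hv hvT ↦ ⟨fun hq ↦ add_mem ((hx.2.1 v hv hvT).1 hq) ((hy.2.1 v hv hvT).1 hq),
            fun q hq hqv ↦ add_mem ((hx.2.1 v hv hvT).2 q hq hqv) ((hy.2.1 v hv hvT).2 q hq hqv)⟩,
          fun ℓ' hℓ' ↦ add_mem (hx.2.2 ℓ' hℓ') (hy.2.2 ℓ' hℓ')⟩
      zero_mem' :=
        ⟨fun w ↦ zero_mem _, fun v _ _ ↦ ⟨fun _ ↦ zero_mem _, fun _ _ _ ↦ zero_mem _⟩, fun _ _ ↦ zero_mem _⟩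
      neg_mem' := fun {x} hx ↦
        ⟨fun w ↦ neg_mem (hx.1 w),
          fun v hv hvT ↦ ⟨fun hq ↦ neg_mem ((hx.2.1 v hv hvT).1 hq),
            fun q hq hqv ↦ neg_mem ((hx.2.1 v hv hvT).2 q hq hqv)⟩,
          fun ℓ' hℓ' ↦ neg_mem (hx.2.2 ℓ' hℓ')⟩ }
  set Z := (W.baseChange K).torsionLocalKer ((plK ℓ).adicCompletion K) ((p ^ 1 : ℕ) : ℤ) with hZdef
  have hKumFin : ∀ (v : HeightOneSpectrum (𝓞 K)) (x : Vp W K p),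
      x ∈ selmerLocalKer (W.baseChange K) (v.adicCompletion K) ((p ^ 1 : ℕ) : ℤ) →
        loc (Sum.inr v) x ∈ (W.baseChange K).kummerLocalConditionAt ((p ^ 1 : ℕ) : ℤ) (Place.Completion (Sum.inr v : Place K)) := by
    intro v x hx; rw [hloc]; exact (mem_selmerLocalKer_iff_localization_mem_kummer_P W K p v x).mp hx
  have hKumInf : ∀ (w : InfinitePlace K) (x : Vp W K p),
      x ∈ selmerLocalKer (W.baseChange K) w.Completion ((p ^ 1 : ℕ) : ℤ) →
        loc (Sum.inl w) x ∈ (W.baseChange K).kummerLocalConditionAt ((p ^ 1 : ℕ) : ℤ) (Place.Completion (Sum.inl w : Place K)) := by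
    intro w x hx; rw [hloc]; exact (mem_selmerLocalKer_iff_localization_mem_kummer_inf_P W K p w x).mp hx
  -- (orth): `loc_λ(G)` is isotropic
  have horth : ∀ x y : Vp W K p, x ∈ G → y ∈ G → b (Sum.inr (plK ℓ)) (loc (Sum.inr (plK ℓ)) x) (loc (Sum.inr (plK ℓ)) y) = 0 := by
    intro x y hx hy
    have h := hrec x y {(Sum.inr (plK ℓ) : Place K)} fun v hv ↦ ?_
    · rwa [Finset.sum_singleton] at h
    have hv' : v ≠ Sum.inr (plK ℓ) := fun h ↦ hv (Finset.mem_singleton.mpr h)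
    rcases v with w | v
    · exact hisoKum (Sum.inl w) _ (hKumInf w x (hx.1 w)) _ (hKumInf w y (hy.1 w))
    · have hvℓ : v ≠ plK ℓ := fun h ↦ hv' (by rw [h])
      by_cases hvT : ∃ ℓ' ∈ m, plK ℓ' = v
      · obtain ⟨ℓ', hℓ'T, rfl⟩ := hvT
        exact hisoTr ℓ' x y (hx.2.2 ℓ' hℓ'T) (hy.2.2 ℓ' hℓ'T)
      · push Not at hvT
        by_cases hq : ∃ q ∈ n, ((q : ℕ) : 𝓞 K) ∈ v.asIdeal
        · obtain ⟨q, hq, hqv⟩ := hq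
          exact hisoTor q v hqv x y ((hx.2.1 v hvℓ hvT).2 q hq hqv) ((hy.2.1 v hvℓ hvT).2 q hq hqv)
        · push Not at hq
          exact hisoKum (Sum.inr v) _ (hKumFin v x ((hx.2.1 v hvℓ hvT).1 hq)) _ (hKumFin v y ((hy.2.1 v hvℓ hvT).1 hq))
  -- (dec): eigen-decomposition inside the `conjAct`-stable subgroup `G`
  have hc2 : c * c = 1 := algEquiv_mul_self_eq_one K hK c
  have hpV : ∀ a : Vp W K p, p • a = 0 := fun a ↦ by
    rw [← Nat.cast_smul_eq_nsmul (ZMod p), ZMod.natCast_self, zero_smul]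
  have hτ : ∀ a : Vp W K p, conjAct W c ((p ^ 1 : ℕ) : ℤ) (conjAct W c ((p ^ 1 : ℕ) : ℤ) a) = a := fun a ↦ conjAct_conjAct_of_mul_self W hc2 _ a
  have hG : ∀ a ∈ G, conjAct W c ((p ^ 1 : ℕ) : ℤ) a ∈ G := by
    intro a ha
    -- (Stab) in place currency (`conjAct_mem_relaxedGroupP`), converted
    have ha' : (∀ w : InfinitePlace K, a ∈ selmerLocalKer (W.baseChange K) w.Completion ((p ^ 1 : ℕ) : ℤ)) ∧
        (∀ v : HeightOneSpectrum (𝓞 K), ((ℓ : ℕ) : 𝓞 K) ∉ v.asIdeal →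
          (∀ ℓ' ∈ m, ((ℓ' : ℕ) : 𝓞 K) ∉ v.asIdeal) →
          ((∀ q ∈ n, ((q : ℕ) : 𝓞 K) ∉ v.asIdeal) → a ∈ selmerLocalKer (W.baseChange K) (v.adicCompletion K) ((p ^ 1 : ℕ) : ℤ)) ∧
          (∀ q ∈ n, ((q : ℕ) : 𝓞 K) ∈ v.asIdeal → a ∈ toricLocalKer (W.baseChange K) (v.adicCompletion K) ((p ^ 1 : ℕ) : ℤ))) ∧
        (∀ ℓ' ∈ m, ∀ v : HeightOneSpectrum (𝓞 K), ((ℓ' : ℕ) : 𝓞 K) ∈ v.asIdeal → a ∈ transverseLocalKerP W K p ι ℓ' v) := by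
      refine ⟨ha.1, fun v hv hvT ↦ ha.2.1 v ((hcur ℓ v).mpr hv) (fun ℓ' hℓ' ↦ ((hcur ℓ' v).mpr (hvT ℓ' hℓ')).symm),
        fun ℓ' hℓ' v hv ↦ ?_⟩
      have hveq : v = plK ℓ' := by
        by_contra hne
        exact (hcur ℓ' v).mp hne hv
      rw [hveq]
      exact ha.2.2 ℓ' hℓ'
    have h := conjAct_mem_relaxedGroupP W p hK hc ι n ℓ m a ha'
    exact ⟨h.1, fun v hv hvT ↦ h.2.1 v ((hcur ℓ v).mp hv) (fun ℓ' hℓ' ↦ (hcur ℓ' v).mp (hvT ℓ' hℓ').symm),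
      fun ℓ' hℓ' ↦ h.2.2 ℓ' hℓ' (plK ℓ') (hplK ℓ')⟩
  have hsgn : sgnP μ = 1 ∨ sgnP μ = -1 := by cases μ <;> simp [sgnP]
  have hsgn' : sgnP (!μ) = -sgnP μ := by cases μ <;> rfl
  have hdec : ∀ x, x ∈ G → ∃ y z, y ∈ G ∧ conjAct W c ((p ^ 1 : ℕ) : ℤ) y = sgnP μ • y ∧ z ∈ G ∧
      conjAct W c ((p ^ 1 : ℕ) : ℤ) z = sgnP (!μ) • z ∧ x = y + z := by
    intro x hx
    obtain ⟨y, hy, z, hz, hyτ, hzτ, hxyz⟩ :=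
      exists_eigen_decomposition (n := p) (hp.odd_of_ne_two hp2) hpV (conjAct W c ((p ^ 1 : ℕ) : ℤ)) hτ hsgn G hG hx
    exact ⟨y, z, hy, hyτ, hz, by rw [hsgn']; exact hzτ, hxyz⟩
  obtain ⟨x, hxG, hxE, hxZ⟩ := exists_eigen_not_mem_of_jump Z (· ∈ G)
    (fun s' x ↦ conjAct W c ((p ^ 1 : ℕ) : ℤ) x = sgnP s' • x)
    (fun x y ↦ b (Sum.inr (plK ℓ)) (loc (Sum.inr (plK ℓ)) x) (loc (Sum.inr (plK ℓ)) y) = 0) μ hdec horth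
    (fun x₀ ↦ hjump n hn ℓ m hℓm x₀) (fun x y hx hy ↦ hbound ℓ (!μ) x y hx hy)
  -- back to place currency
  have hneq : ∀ (ℓ' : {ℓ // Zhang2014.IsKolyvaginPrime (W.conductorNorm ℤ) W K p ℓ}) (q : AdmQ W K p), (q : ℕ) ≠ (ℓ' : ℕ) := by
    intro ℓ' q h
    have hk : 1 ≤ Zhang2014.kolyvaginIndex W p (ℓ' : ℕ) := ℓ'.2.2.2.2.2.2
    have hdvd : p ^ 1 ∣ (ℓ' : ℕ) + 1 := (Zhang2014.le_kolyvaginIndex_iff.mp hk).1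
    rw [pow_one, ← h] at hdvd
    have hq : ¬ ((p : ℤ) ∣ ((q : ℕ) : ℤ) ^ 2 - 1) := q.2.2.2.2.1
    apply hq
    have : ((q : ℕ) : ℤ) ^ 2 - 1 = (((q : ℕ) : ℤ) + 1) * (((q : ℕ) : ℤ) - 1) := by ring
    rw [this]
    exact Dvd.dvd.mul_right (by exact_mod_cast hdvd) _
  have hoff : ∀ (q : AdmQ W K p) (w : HeightOneSpectrum (𝓞 K)), ((q : ℕ) : 𝓞 K) ∈ w.asIdeal →
      w ≠ plK ℓ ∧ ∀ ℓ' ∈ m, plK ℓ' ≠ w := fun q w hqw ↦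
    ⟨(hcur ℓ w).mpr (not_natCast_mem_of_prime_ne (K := K) q.2.1 ℓ.2.1 (hneq ℓ q) w hqw),
      fun ℓ' _ ↦ ((hcur ℓ' w).mpr (not_natCast_mem_of_prime_ne (K := K) q.2.1 ℓ'.2.1 (hneq ℓ' q) w hqw)).symm⟩
  refine ⟨x, hxE, ⟨hxG.1, fun w hw hwT hq ↦ (hxG.2.1 w ((hcur ℓ w).mpr hw)
    (fun ℓ' hℓ' ↦ ((hcur ℓ' w).mpr (hwT ℓ' hℓ')).symm)).1 hq,
    fun q hq w hqw ↦ (hxG.2.1 w (hoff q w hqw).1 (hoff q w hqw).2).2 q hq hqw, fun ℓ' hℓ' w hw ↦ ?_⟩, by rw [← hvℓ]; exact hxZ⟩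
  have hweq : w = plK ℓ' := by
    by_contra hne
    exact (hcur ℓ' w).mp hne hw
  rw [hweq]
  exact hxG.2.2 ℓ' hℓ'

/-! ## §2 The `hJump` binder of (Twin) from the detected supply and the LOCAL TRICHOTOMY at a Kolyvagin prime -/

/-- **(Twin), JUMP binder, modulo the local trichotomy.** Frame as in §1; `Mix` the mixed spaces through their membership dictionary.
HYPOTHESIS (TRICH, the ONE remaining local input): a `μ`-eigenclass of the `λ`-relaxed mixed structure which is NOT Kummer at `λ` is TRANSVERSE at
`λ` (Howard's «elementary linear algebra exercise»: the isotropic lines of the hyperbolic eigen-plane `H¹(K_λ, E[p])^μ` are the finite and the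
transverse ones — Gross Prop. 8.1–8.2; route in the tree: `h1Eval_frob_eq_zero_of_cupProduct_self_eq_zero_P` + `χ(F)² = 1` for the symmetric
Frobenius lift). CONCLUSION: literally the binder `hJump` of `nonempty_levelKolyvaginSystemP_of_seed_of_twin` — at a non-empty level one of
`Sel(m, n)^μ`, `Sel(mℓ, n)^μ` has a class detected above `ℓ`: the detected eigenclass of §1 is Kummer at `λ` (then in `Sel(m, n)^μ`) or transverse
(then in `Sel(mℓ, n)^μ`). [cite: Howard2004HeegnerKolyvagin, Lemma 2.5.3] [cite: WZhang2014, Lemma 8.2] [cite: GrossLMS1991, Prop. 8.1, Prop. 8.2] -/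
theorem twinJump_mixed_of_trich
    [∀ v : Place K, Module (ZMod p) (galoisCohomology (((W.baseChange K).torsionGaloisModule ((p ^ 1 : ℕ) : ℤ)).toLocal v) 1)]
    (hK : IsImaginaryQuadratic K) (hp2 : p ≠ 2) (hd : NumberField.discr K < -4)
    (hsurj : W.HasSurjectiveModNGaloisRep p) (hc : c ≠ 1) (hPT : poitouTate_selmerStructure_duality K)
    (htrich : (∀ (m : Finset {ℓ // Zhang2014.IsKolyvaginPrime (W.conductorNorm ℤ) W K p ℓ}) (ℓ : {ℓ // Zhang2014.IsKolyvaginPrime (W.conductorNorm ℤ) W K p ℓ}) (n : Finset (AdmQ W K p)) (v : HeightOneSpectrum (𝓞 K)) (μ : Bool)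
      (x : Vp W K p), ℓ ∉ m → ((ℓ : ℕ) : 𝓞 K) ∈ v.asIdeal → conjAct W c ((p ^ 1 : ℕ) : ℤ) x = sgnP μ • x →
      ((∀ w : InfinitePlace K, x ∈ selmerLocalKer (W.baseChange K) w.Completion ((p ^ 1 : ℕ) : ℤ)) ∧
      (∀ w : HeightOneSpectrum (𝓞 K), ((ℓ : ℕ) : 𝓞 K) ∉ w.asIdeal → (∀ ℓ' ∈ m, ((ℓ' : ℕ) : 𝓞 K) ∉ w.asIdeal) →
        (∀ q ∈ n, ((q : ℕ) : 𝓞 K) ∉ w.asIdeal) → x ∈ selmerLocalKer (W.baseChange K) (w.adicCompletion K) ((p ^ 1 : ℕ) : ℤ)) ∧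
      (∀ q ∈ n, ∀ w : HeightOneSpectrum (𝓞 K), ((q : ℕ) : 𝓞 K) ∈ w.asIdeal →
        x ∈ toricLocalKer (W.baseChange K) (w.adicCompletion K) ((p ^ 1 : ℕ) : ℤ)) ∧
      (∀ ℓ' ∈ m, ∀ w : HeightOneSpectrum (𝓞 K), ((ℓ' : ℕ) : 𝓞 K) ∈ w.asIdeal → x ∈ transverseLocalKerP W K p ι ℓ' w)) →
      x ∉ selmerLocalKer (W.baseChange K) (v.adicCompletion K) ((p ^ 1 : ℕ) : ℤ) → x ∈ transverseLocalKerP W K p ι ℓ v))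
    (Mix : Finset {ℓ // Zhang2014.IsKolyvaginPrime (W.conductorNorm ℤ) W K p ℓ} → Finset (AdmQ W K p) → Bool → Submodule (ZMod p) (Vp W K p))
    (hMix : ∀ (m : Finset {ℓ // Zhang2014.IsKolyvaginPrime (W.conductorNorm ℤ) W K p ℓ}) (n : Finset (AdmQ W K p)) (μ : Bool) (x : Vp W K p),
      x ∈ Mix m n μ ↔ (conjAct W c ((p ^ 1 : ℕ) : ℤ) x = sgnP μ • x ∧
        (∀ w : InfinitePlace K, x ∈ selmerLocalKer (W.baseChange K) w.Completion ((p ^ 1 : ℕ) : ℤ)) ∧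
        (∀ v : HeightOneSpectrum (𝓞 K), (∀ ℓ ∈ m, ((ℓ : ℕ) : 𝓞 K) ∉ v.asIdeal) → (∀ q ∈ n, ((q : ℕ) : 𝓞 K) ∉ v.asIdeal) →
          x ∈ selmerLocalKer (W.baseChange K) (v.adicCompletion K) ((p ^ 1 : ℕ) : ℤ)) ∧
        (∀ q ∈ n, ∀ v : HeightOneSpectrum (𝓞 K), ((q : ℕ) : 𝓞 K) ∈ v.asIdeal →
          x ∈ toricLocalKer (W.baseChange K) (v.adicCompletion K) ((p ^ 1 : ℕ) : ℤ)) ∧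
        (∀ ℓ ∈ m, ∀ v : HeightOneSpectrum (𝓞 K), ((ℓ : ℕ) : 𝓞 K) ∈ v.asIdeal → x ∈ transverseLocalKerP W K p ι ℓ v))) :
    ∀ (m : Finset {ℓ // Zhang2014.IsKolyvaginPrime (W.conductorNorm ℤ) W K p ℓ}) (ℓ : {ℓ // Zhang2014.IsKolyvaginPrime (W.conductorNorm ℤ) W K p ℓ}) (n : Finset (AdmQ W K p)) (μ : Bool), ℓ ∉ m → n.Nonempty →
      (∃ x ∈ Mix m n μ, ¬ (∀ v : HeightOneSpectrum (𝓞 K), ((ℓ : ℕ) : 𝓞 K) ∈ v.asIdeal → x ∈ (W.baseChange K).torsionLocalKer (v.adicCompletion K) ((p ^ 1 : ℕ) : ℤ))) ∨ (∃ y ∈ Mix (insert ℓ m) n μ, ¬ (∀ v : HeightOneSpectrum (𝓞 K), ((ℓ : ℕ) : 𝓞 K) ∈ v.asIdeal → y ∈ (W.baseChange K).torsionLocalKer (v.adicCompletion K) ((p ^ 1 : ℕ) : ℤ))) := by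
  intro m ℓ n μ hℓm hn
  -- the place above `ℓ`
  have hℓP : (Ideal.span {((ℓ : ℕ) : 𝓞 K)}).IsPrime := ℓ.2.2.2.2.2.1
  have hbot : Ideal.span {((ℓ : ℕ) : 𝓞 K)} ≠ ⊥ := by
    rw [Ne, Ideal.span_singleton_eq_bot]; exact_mod_cast ℓ.2.1.ne_zero
  let v : HeightOneSpectrum (𝓞 K) := ⟨Ideal.span {((ℓ : ℕ) : 𝓞 K)}, hℓP, hbot⟩
  have hv : ((ℓ : ℕ) : 𝓞 K) ∈ v.asIdeal := Ideal.mem_span_singleton_self _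
  have huniq : ∀ w : HeightOneSpectrum (𝓞 K), ((ℓ : ℕ) : 𝓞 K) ∈ w.asIdeal → w = v :=
    fun w hw ↦ placesAbove_eq_of_isPrime_span K hℓP ℓ.2.1.ne_zero hv hw
  obtain ⟨x, hxs, hxR, hx0⟩ := exists_detected_eigen_mixedRelaxed W K p c ι hK hp2 hd hsurj hc hPT m ℓ hℓm n hn v hv μ
  have hnot : ¬ (∀ v : HeightOneSpectrum (𝓞 K), ((ℓ : ℕ) : 𝓞 K) ∈ v.asIdeal → x ∈ (W.baseChange K).torsionLocalKer (v.adicCompletion K) ((p ^ 1 : ℕ) : ℤ)) := fun h ↦ hx0 (h v hv)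
  by_cases hxK : x ∈ selmerLocalKer (W.baseChange K) (v.adicCompletion K) ((p ^ 1 : ℕ) : ℤ)
  · -- Kummer at `λ`: a detected class of `Sel(m, n)^μ`
    refine Or.inl ⟨x, (hMix m n μ x).mpr ⟨hxs, hxR.1, fun w hm hn' ↦ ?_, hxR.2.2.1, hxR.2.2.2⟩, hnot⟩
    by_cases hℓw : ((ℓ : ℕ) : 𝓞 K) ∈ w.asIdeal
    · rw [huniq w hℓw]; exact hxK
    · exact hxR.2.1 w hℓw hm hn'
  · -- transverse at `λ` (TRICH): a detected class of `Sel(mℓ, n)^μ`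
    have hxT := htrich m ℓ n v μ x hℓm hv hxs hxR hxK
    refine Or.inr ⟨x, (hMix (insert ℓ m) n μ x).mpr ⟨hxs, hxR.1, fun w hm hn' ↦ ?_, hxR.2.2.1, fun ℓ'' hℓ'' w hw ↦ ?_⟩, hnot⟩
    · exact hxR.2.1 w (hm ℓ (Finset.mem_insert_self ℓ m)) (fun ℓ' hℓ' ↦ hm ℓ' (Finset.mem_insert_of_mem hℓ')) hn'
    · rcases Finset.mem_insert.mp hℓ'' with rfl | hℓ''
      · rw [huniq w hw]; exact hxT
      · exact hxR.2.2.2 ℓ'' hℓ'' w hw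

end Summit.BirchSwinnertonDyer.BirchSwinnertonDyer.Theorems.AdditiveKoly

end
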